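import Mathlib
import Summits.ValiantsHypothesis.ValiantsHypothesis.Theorems.NewtonUnitEquationsTwoProductsFormalLogLinearisationLiftedNecessity
import Summits.ValiantsHypothesis.ValiantsHypothesis.Theorems.NewtonUnitEquationsTwoProductsFormalLogLinearisationLiftedHyperbolicCross
import Summits.ValiantsHypothesis.ValiantsHypothesis.Theorems.NewtonUnitEquationsTwoProductsFormalLogLinearisationLiftedSlotRank
import Summits.ValiantsHypothesis.ValiantsHypothesis.Theorems.NewtonUnitEquationsTwoProductsFormalLogLinearisationLiftedOverlapPencil
import HarnessLib

/-!
# Line `planar_cell` — RUNG: SUB₁ `PlanarCross` below the first additive coincidence (val-idea-8 g0)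

`planarCross_local`: for tails `u, v` (zero constant terms, ANY sparsity), an injective enumeration `E` of the tail
support, and a point `l` that is the strict `ξ`-top of `supp D` (`D = Σ log(1+u_j) − Σ log(1+v_j)`; `ξ` arbitrary —
validity is not even needed), IF the exponent map `Λ_E` is injective on the ZONE `{μ : wt ξ l ≤ wt ξ (Λ_E μ)}` (no additive
coincidence of `E` at or above the level of `l`), THEN `l = Λ_E μ` with `∏ (μ_i + 1) ≤ 2m` — the body of `PlanarCross`
with `c = 1` (value `2m ≤ (2m)^1`).  Proof: on the zone every fibre is a singleton, so the planar log-coefficient is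
`lcoef(μ)·G(μ)` with `lcoef(μ) = (−1)^{|μ|+1}(|μ|−1)!·multinomial ≠ 0` (`logDiff_eq_lifted_sum`, p586149-family), hence the
unique preimage of `l` is a strict lifted minimiser of `{G ≠ 0}` for the grading `θ_i = −wt ξ E_i`, and
`unequalMoment_hyperbolicCross` (p591055-family) applies.  This is the DISSOCIATED calibration of the line card made
kernel-checked: SUB₁'s entire content is the behaviour AT additive coincidences.
`planarSlotBound_local` / `planarSlotBound_charged`: the SUB₂ body with value `2m` when `Λ_E` is injective on the member's zone, resp.
(sharpest form) when only the fibres the slot matrix actually reads — at each `rep d` and at each slot-shift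
`(rep d ∖ slot) + e·e_{d'}`, `d' ∈ D` — are singletons.  COROLLARY (stated, immediate): for an arbitrary slot family,
`#D ≤ 2m + #{coincidence-touched members}` — the t-free content of SUB₂ is exactly `2m`; all further multiplicity is carried by
additive coincidences of the tail support (val-lit p3 g13's ghost-pair staircase, RULING #131, touches every column: SUB₂ as a
t-free statement is FALSE, and this file says precisely what the refutation exploits).
`card_le_two_mul_add_card_touched` (v3): the counting corollary `#D ≤ 2m + #T` for any `T ⊇ touched members` — PROVED.
Honest frame: rungs/structure theorems; SUB₂ REFUTED (p3), SUB₁/PlanarCellBound/crux OPEN; VP ≠ VNP not moved.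
-/

set_option linter.dupNamespace false
set_option linter.unusedSectionVars false
set_option linter.style.longFile 0

noncomputable section

open scoped BigOperators
open MvPolynomial
open Summit.ValiantsHypothesis.ValiantsHypothesis.Theorems.NewtonUnitEquations.TwoProducts.FormalLogLinearisation

namespace Summit.ValiantsHypothesis.ValiantsHypothesis.Cruxes.TwoProducts.PlanarCellRung

variable {m : ℕ}

/-! ## Copies of the line's elementary objects (verbatim from `Lines/planar_cell.lean`, so that this rung file is
self-contained — the Lines module is a workfile, not a built import) -/

/-- The exponent map `Λ_E : ℕ^s → ℕ²` (verbatim the line's `lam`). -/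
def lam {s : ℕ} (E : Fin s → Expo) (μ : Fin s → ℕ) : Expo := ∑ i, μ i • E i

/-- The tail support (verbatim the line's `tailSupport` = p596451's inline union). -/
def tailSupport (u v : Fin m → MvPolynomial (Fin 2) ℂ) : Finset Expo :=
  (Finset.univ.biUnion fun j => (u j).support) ∪ Finset.univ.biUnion fun j => (v j).support

theorem wt_add (ξ : Fin 2 → ℝ) (a b : Expo) : wt ξ (a + b) = wt ξ a + wt ξ b := by
  simp only [wt, Finsupp.coe_add, Pi.add_apply, Nat.cast_add]
  ring

theorem wt_nsmul (ξ : Fin 2 → ℝ) (k : ℕ) (a : Expo) : wt ξ (k • a) = (k : ℝ) * wt ξ a := by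
  simp only [wt, Finsupp.coe_smul, Pi.smul_apply, smul_eq_mul, Nat.cast_mul]
  ring

theorem wt_sum {ι : Type*} (ξ : Fin 2 → ℝ) (S : Finset ι) (g : ι → Expo) :
    wt ξ (∑ i ∈ S, g i) = ∑ i ∈ S, wt ξ (g i) := by
  classical
  induction S using Finset.induction_on with
  | empty => simp [wt]
  | insert a S ha ih => rw [Finset.sum_insert ha, Finset.sum_insert ha, wt_add, ih]

theorem wt_lam {s : ℕ} (ξ : Fin 2 → ℝ) (E : Fin s → Expo) (μ : Fin s → ℕ) :
    wt ξ (lam E μ) = ∑ i, (μ i : ℝ) * wt ξ (E i) := by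
  unfold lam
  rw [wt_sum]
  exact Finset.sum_congr rfl fun i _ => wt_nsmul ξ (μ i) (E i)

/-- The unequal-moment function `G(μ) = Σ_j A_j^μ − Σ_j B_j^μ`. -/
def umom {s : ℕ} (A B : Fin m → Fin s → ℂ) (μ : Fin s → ℕ) : ℂ :=
  (∑ j, ∏ i, A j i ^ μ i) - (∑ j, ∏ i, B j i ^ μ i)

/-- The scalar attached to a multi-index in the formal logarithm: `(−1)^{|k|+1}/|k| · multinomial(k)`. -/
def lcoef {s : ℕ} (k : Fin s → ℕ) : ℂ :=
  (-1 : ℂ) ^ ((∑ i, k i) + 1) / ((∑ i, k i : ℕ) : ℂ) * (Nat.multinomial Finset.univ k : ℂ)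

theorem umom_zero {s : ℕ} (A B : Fin m → Fin s → ℂ) : umom A B 0 = 0 := by
  simp [umom]

theorem lcoef_ne_zero {s : ℕ} (k : Fin s → ℕ) (hk : k ≠ 0) : lcoef k ≠ 0 := by
  have hpos : 0 < ∑ i, k i := by
    obtain ⟨i, hi⟩ : ∃ i, k i ≠ 0 := by
      by_contra h
      push Not at h
      exact hk (funext h)
    exact lt_of_lt_of_le (Nat.pos_of_ne_zero hi) (Finset.single_le_sum (fun j _ => Nat.zero_le (k j)) (Finset.mem_univ i))
  unfold lcoef
  refine mul_ne_zero (div_ne_zero (pow_ne_zero _ (by norm_num)) ?_) ?_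
  · exact_mod_cast hpos.ne'
  · exact_mod_cast (Nat.multinomial_pos Finset.univ k).ne'

/-- A polynomial whose support lies in the range of an injective enumeration is the sum of its monomials along it. -/
theorem eq_sum_monomial_coeff {s : ℕ} (E : Fin s → Expo) (hE : Function.Injective E)
    (p : MvPolynomial (Fin 2) ℂ) (hp : (↑p.support : Set Expo) ⊆ Set.range E) :
    p = ∑ i, monomial (E i) (coeff (E i) p) := by
  classical
  ext n
  simp only [coeff_sum, coeff_monomial]
  by_cases hn : n ∈ Set.range E
  · obtain ⟨i₀, rfl⟩ := hn
    rw [Finset.sum_eq_single i₀]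
    · simp
    · intro i _ hi
      rw [if_neg (hE.ne hi)]
    · intro h; exact absurd (Finset.mem_univ _) h
  · have h0 : coeff n p = 0 := by
      by_contra h
      exact hn (hp (by simpa [mem_support_iff] using h))
    rw [h0, eq_comm]
    refine Finset.sum_eq_zero fun i _ => ?_
    rw [if_neg]
    rintro rfl
    exact hn ⟨i, rfl⟩

/-- `lam E k` is the `Σ k_i • E_i` of the lifted-sum formula. -/
theorem lam_eq_sum {s : ℕ} (E : Fin s → Expo) (k : Fin s → ℕ) : (∑ i, k i • E i) = lam E k := rfl

/-- The fibre-sum formula for the planar log-coefficients of tails supported on `range E`. -/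
theorem logDiff_eq_fibreSum {s : ℕ} (E : Fin s → Expo) (hE : Function.Injective E)
    (u v : Fin m → MvPolynomial (Fin 2) ℂ)
    (hu : ∀ j, (↑(u j).support : Set Expo) ⊆ Set.range E) (hv : ∀ j, (↑(v j).support : Set Expo) ⊆ Set.range E)
    (n : Expo) :
    logDiff u v n = ∑ r ∈ Finset.Icc 1 (n 0 + n 1), ∑ k ∈ (Finset.univ : Finset (Fin s)).piAntidiag r,
        (if lam E k = n then (-1 : ℂ) ^ (r + 1) / (r : ℂ) * (Nat.multinomial Finset.univ k : ℂ) else 0) *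
          umom (fun j i => coeff (E i) (u j)) (fun j i => coeff (E i) (v j)) k := by
  have hu' : u = fun j => ∑ i, monomial (E i) (coeff (E i) (u j)) :=
    funext fun j => eq_sum_monomial_coeff E hE (u j) (hu j)
  have hv' : v = fun j => ∑ i, monomial (E i) (coeff (E i) (v j)) :=
    funext fun j => eq_sum_monomial_coeff E hE (v j) (hv j)
  have h := logDiff_eq_lifted_sum E (fun j i => coeff (E i) (u j)) (fun j i => coeff (E i) (v j)) n
  rw [← hu', ← hv'] at h
  rw [h]
  rfl

/-- Length is at most planar degree when no `E_i` is zero. -/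
theorem sum_le_deg {s : ℕ} (E : Fin s → Expo) (hE0 : ∀ i, E i ≠ 0) (k : Fin s → ℕ) :
    ∑ i, k i ≤ (lam E k) 0 + (lam E k) 1 := by
  have h1 : ∀ i, 1 ≤ (E i) 0 + (E i) 1 := fun i => by
    by_contra h
    push Not at h
    apply hE0 i
    ext a
    fin_cases a <;> simp <;> omega
  have : (lam E k) 0 + (lam E k) 1 = ∑ i, k i * ((E i) 0 + (E i) 1) := by
    simp only [lam, Finsupp.coe_finsetSum, Finset.sum_apply, Finsupp.coe_smul, Pi.smul_apply, smul_eq_mul]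
    rw [← Finset.sum_add_distrib]
    exact Finset.sum_congr rfl fun i _ => by ring
  rw [this]
  exact Finset.sum_le_sum fun i _ => by nlinarith [h1 i]

/-- Pointwise form: if the fibre of `Λ_E μ` is the singleton `{μ}` (`μ ≠ 0`), the planar log-coefficient sum at `Λ_E μ`
collapses to `lcoef(μ)·G(μ)`. -/
theorem fibreSum_eq_single' {s : ℕ} (E : Fin s → Expo) (hE0 : ∀ i, E i ≠ 0) (G : (Fin s → ℕ) → ℂ) (μ : Fin s → ℕ)
    (hfib : ∀ k : Fin s → ℕ, lam E k = lam E μ → k = μ) (hμ0 : μ ≠ 0) :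
    (∑ r ∈ Finset.Icc 1 ((lam E μ) 0 + (lam E μ) 1), ∑ k ∈ (Finset.univ : Finset (Fin s)).piAntidiag r,
        (if lam E k = lam E μ then (-1 : ℂ) ^ (r + 1) / (r : ℂ) * (Nat.multinomial Finset.univ k : ℂ) else 0) * G k)
      = lcoef μ * G μ := by
  classical
  have hpos : 1 ≤ ∑ i, μ i := by
    obtain ⟨i, hi⟩ : ∃ i, μ i ≠ 0 := by
      by_contra h
      push Not at h
      exact hμ0 (funext h)
    exact le_trans (Nat.one_le_iff_ne_zero.mpr hi)
      (Finset.single_le_sum (fun j _ => Nat.zero_le (μ j)) (Finset.mem_univ i))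
  rw [Finset.sum_eq_single (∑ i, μ i)]
  · rw [Finset.sum_eq_single μ]
    · simp [lcoef]
    · intro k hk hne
      rw [if_neg (fun h => hne (hfib k h)), zero_mul]
    · intro h
      exact absurd (by simp [Finset.mem_piAntidiag]) h
  · intro r _ hr
    refine Finset.sum_eq_zero fun k hk => ?_
    have hks : ∑ i, k i = r := by simpa [Finset.mem_piAntidiag] using hk
    rw [if_neg, zero_mul]
    intro h
    have := hfib k h
    subst this
    exact hr hks.symm
  · intro h
    exact absurd (Finset.mem_Icc.mpr ⟨hpos, sum_le_deg E hE0 μ⟩) h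

/-- SINGLETON FIBRES COLLAPSE THE FIBRE SUM: if `Λ_E` is injective on the zone `{μ : P (Λ_E μ)}` and `μ ≠ 0` lies in it,
the planar log-coefficient at `Λ_E μ` is `lcoef(μ)·G(μ)`. -/
theorem fibreSum_eq_single {s : ℕ} (E : Fin s → Expo) (hE0 : ∀ i, E i ≠ 0) (P : Expo → Prop)
    (hinj : Set.InjOn (lam E) {μ | P (lam E μ)}) (G : (Fin s → ℕ) → ℂ) (μ : Fin s → ℕ) (hμ : P (lam E μ))
    (hμ0 : μ ≠ 0) :
    (∑ r ∈ Finset.Icc 1 ((lam E μ) 0 + (lam E μ) 1), ∑ k ∈ (Finset.univ : Finset (Fin s)).piAntidiag r,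
        (if lam E k = lam E μ then (-1 : ℂ) ^ (r + 1) / (r : ℂ) * (Nat.multinomial Finset.univ k : ℂ) else 0) * G k)
      = lcoef μ * G μ := by
  classical
  -- every contributing index equals `μ`
  have hfib : ∀ k : Fin s → ℕ, lam E k = lam E μ → k = μ := fun k hk =>
    hinj (show P (lam E k) by rw [hk]; exact hμ) hμ hk
  have hpos : 1 ≤ ∑ i, μ i := by
    obtain ⟨i, hi⟩ : ∃ i, μ i ≠ 0 := by
      by_contra h
      push Not at h
      exact hμ0 (funext h)
    exact le_trans (Nat.one_le_iff_ne_zero.mpr hi)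
      (Finset.single_le_sum (fun j _ => Nat.zero_le (μ j)) (Finset.mem_univ i))
  rw [Finset.sum_eq_single (∑ i, μ i)]
  · rw [Finset.sum_eq_single μ]
    · simp [lcoef]
    · intro k hk hne
      rw [if_neg (fun h => hne (hfib k h)), zero_mul]
    · intro h
      exact absurd (by simp [Finset.mem_piAntidiag]) h
  · intro r _ hr
    refine Finset.sum_eq_zero fun k hk => ?_
    have hks : ∑ i, k i = r := by simpa [Finset.mem_piAntidiag] using hk
    rw [if_neg, zero_mul]
    intro h
    have := hfib k h
    subst this
    exact hr hks.symm
  · intro h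
    exact absurd (Finset.mem_Icc.mpr ⟨hpos, sum_le_deg E hE0 μ⟩) h

theorem logDiff_zero' (u v : Fin m → MvPolynomial (Fin 2) ℂ) : logDiff u v 0 = 0 := by
  simp [logDiff, logCoeff]

/-- **RUNG (SUB₁ below the first coincidence).**  A strict top of `supp D` whose zone `{μ : wt ξ l ≤ wt ξ (Λ_E μ)}` carries
no additive coincidence of the tail support lies in the `2m`-hyperbolic cross: `l = Λ_E μ` with `∏ (μ_i+1) ≤ 2m`.  No
sparsity and no validity of `ξ` are used. -/
theorem planarCross_local (u v : Fin m → MvPolynomial (Fin 2) ℂ)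
    (hu0 : ∀ j, coeff 0 (u j) = 0) (hv0 : ∀ j, coeff 0 (v j) = 0)
    {s : ℕ} (E : Fin s → Expo) (hE : Function.Injective E) (hEr : Set.range E = ↑(tailSupport u v))
    (ξ : Fin 2 → ℝ) (l : Expo) (hl : IsStrictTop ξ (logSupport u v) l)
    (hinj : Set.InjOn (lam E) {μ | wt ξ l ≤ wt ξ (lam E μ)}) :
    ∃ μ : Fin s → ℕ, lam E μ = l ∧ ∏ i, (μ i + 1) ≤ 2 * m := by
  classical
  -- supports inside `range E`, and no `E i` is zero
  have hu : ∀ j, (↑(u j).support : Set Expo) ⊆ Set.range E := fun j e he => by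
    rw [hEr]
    simp only [Finset.mem_coe, tailSupport, Finset.mem_union, Finset.mem_biUnion, Finset.mem_univ, true_and]
    exact Or.inl ⟨j, he⟩
  have hv : ∀ j, (↑(v j).support : Set Expo) ⊆ Set.range E := fun j e he => by
    rw [hEr]
    simp only [Finset.mem_coe, tailSupport, Finset.mem_union, Finset.mem_biUnion, Finset.mem_univ, true_and]
    exact Or.inr ⟨j, he⟩
  have hE0 : ∀ i, E i ≠ 0 := fun i h => by
    have hi : E i ∈ (↑(tailSupport u v) : Set Expo) := by rw [← hEr]; exact ⟨i, rfl⟩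
    simp only [Finset.mem_coe, tailSupport, Finset.mem_union, Finset.mem_biUnion, Finset.mem_univ, true_and,
      mem_support_iff] at hi
    rcases hi with ⟨j, hj⟩ | ⟨j, hj⟩
    · exact hj (by rw [h]; exact hu0 j)
    · exact hj (by rw [h]; exact hv0 j)
  set A : Fin m → Fin s → ℂ := fun j i => coeff (E i) (u j) with hA
  set B : Fin m → Fin s → ℂ := fun j i => coeff (E i) (v j) with hB
  have hF := logDiff_eq_fibreSum E hE u v hu hv
  -- a preimage of `l`
  have hl0 : logDiff u v l ≠ 0 := hl.1
  obtain ⟨μ, hμl⟩ : ∃ μ : Fin s → ℕ, lam E μ = l := by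
    rw [hF l] at hl0
    obtain ⟨r, -, hr⟩ := Finset.exists_ne_zero_of_sum_ne_zero hl0
    obtain ⟨k, -, hk⟩ := Finset.exists_ne_zero_of_sum_ne_zero hr
    by_cases h : lam E k = l
    · exact ⟨k, h⟩
    · simp [h] at hk
  have hμ0 : μ ≠ 0 := by
    rintro rfl
    apply hl0
    rw [← hμl]
    simp [lam, logDiff_zero']
  -- the coefficient at `l` is `lcoef μ · G μ`
  have hzoneμ : wt ξ l ≤ wt ξ (lam E μ) := by rw [hμl]
  have hcoef : logDiff u v l = lcoef μ * umom A B μ := by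
    rw [hF l, ← hμl]
    exact fibreSum_eq_single E hE0 (fun p => wt ξ l ≤ wt ξ p) (by simpa [hμl] using hinj) (umom A B) μ
      (by rw [hμl]) hμ0
  have hGμ : umom A B μ ≠ 0 := fun h => hl0 (by rw [hcoef, h, mul_zero])
  refine ⟨μ, hμl, ?_⟩
  -- hyperbolic cross for the grading `θ_i = −wt ξ (E i)`
  refine unequalMoment_hyperbolicCross A B (fun i => -wt ξ (E i)) μ (sub_ne_zero.mp hGμ) fun ν hne hle => ?_
  have hwt : ∀ k : Fin s → ℕ, ∑ i, -wt ξ (E i) * (k i : ℝ) = -wt ξ (lam E k) := fun k => by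
    rw [wt_lam, ← Finset.sum_neg_distrib]
    exact Finset.sum_congr rfl fun i _ => by ring
  rw [hwt, hwt, neg_le_neg_iff, hμl] at hle
  -- `Λ ν` is in the zone, differs from `l`, hence is not in the support
  have hne' : lam E ν ≠ l := fun h => hne (hinj (show wt ξ l ≤ wt ξ (lam E ν) by rw [h]) hzoneμ (h.trans hμl.symm))
  have hnot : lam E ν ∉ logSupport u v := fun hmem => absurd (hl.2 _ hmem hne') (not_lt.mpr hle)
  have hzero : logDiff u v (lam E ν) = 0 := by
    by_contra h
    exact hnot h
  by_cases hν0 : ν = 0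
  · subst hν0
    exact sub_eq_zero.mp (umom_zero A B)
  · have hc : logDiff u v (lam E ν) = lcoef ν * umom A B ν := by
      rw [hF (lam E ν)]
      exact fibreSum_eq_single E hE0 (fun p => wt ξ l ≤ wt ξ p) hinj (umom A B) ν hle hν0
    rw [hzero] at hc
    have := (mul_eq_zero.mp hc.symm).resolve_left (lcoef_ne_zero ν hν0)
    exact sub_eq_zero.mp this


theorem lam_add_single {s : ℕ} (E : Fin s → Expo) (ρ : Fin s → ℕ) (j : Fin s) (e : ℕ) :
    lam E (ρ + (Pi.single j e : Fin s → ℕ)) = lam E ρ + e • E j := by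
  classical
  unfold lam
  simp only [Pi.add_apply, add_smul, Finset.sum_add_distrib]
  congr 1
  rw [Finset.sum_eq_single j]
  · simp
  · intro i _ hi; simp [hi]
  · intro h; exact absurd (Finset.mem_univ j) h

/-- The signed `2m`-term exponential sum of the two coefficient configurations is the unequal-moment function. -/
theorem expSum_elim_eq_umom {s : ℕ} (A B : Fin m → Fin s → ℂ) (ν : Fin s → ℕ) :
    (∑ k, (Sum.elim (fun _ => (1 : ℂ)) (fun _ => -1) k) * ∏ i, (Sum.elim A B k) i ^ ν i) = umom A B ν := by
  rw [Fintype.sum_sum_type]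
  simp only [umom, Sum.elim_inl, Sum.elim_inr, one_mul, neg_mul, Finset.sum_neg_distrib]
  ring

/-- **RUNG (SUB₂ below the first coincidence).**  In one cell (a relation `R` on the coordinates realised by every
member's weight), a set `D` of coordinates each carrying a representative `rep d` with slot exponent `(rep d)_d = e ≥ 1`
whose planar image is a strict top of `supp D` for a weight `ξ_d`, such that `Λ_E` has no coincidence on the zone of
`rep d`, has `#D ≤ 2m` — the body of `PlanarSlotBound` with value `2m` (and WITHOUT needing the cross restriction or the
distinct-images clause).  Proof: the lifted slot matrix `(G(ρ_y + e·e_{d_x}))` factors through the `2m` signed terms, is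
nonzero on the diagonal (visible ⇒ `G ≠ 0` on a singleton fibre) and vanishes above it (a zone point other than the top has
zero planar coefficient, and its fibre is a singleton). -/
theorem planarSlotBound_local (u v : Fin m → MvPolynomial (Fin 2) ℂ)
    (hu0 : ∀ j, coeff 0 (u j) = 0) (hv0 : ∀ j, coeff 0 (v j) = 0)
    {s : ℕ} (E : Fin s → Expo) (hE : Function.Injective E) (hEr : Set.range E = ↑(tailSupport u v))
    (R : Fin s → Fin s → Prop) (e : ℕ) (he : 1 ≤ e) (D : Finset (Fin s)) (rep : Fin s → (Fin s → ℕ))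
    (ξ : Fin s → (Fin 2 → ℝ))
    (hrep : ∀ d ∈ D, rep d d = e ∧ IsStrictTop (ξ d) (logSupport u v) (lam E (rep d)) ∧
      (∀ j j' : Fin s, R j j' ↔ wt (ξ d) (E j) ≤ wt (ξ d) (E j')) ∧
      Set.InjOn (lam E) {μ | wt (ξ d) (lam E (rep d)) ≤ wt (ξ d) (lam E μ)}) :
    D.card ≤ 2 * m := by
  classical
  -- supports inside `range E`, and no `E i` is zero (as in `planarCross_local`)
  have hu : ∀ j, (↑(u j).support : Set Expo) ⊆ Set.range E := fun j x hx => by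
    rw [hEr]
    simp only [Finset.mem_coe, tailSupport, Finset.mem_union, Finset.mem_biUnion, Finset.mem_univ, true_and]
    exact Or.inl ⟨j, hx⟩
  have hv : ∀ j, (↑(v j).support : Set Expo) ⊆ Set.range E := fun j x hx => by
    rw [hEr]
    simp only [Finset.mem_coe, tailSupport, Finset.mem_union, Finset.mem_biUnion, Finset.mem_univ, true_and]
    exact Or.inr ⟨j, hx⟩
  have hE0 : ∀ i, E i ≠ 0 := fun i h => by
    have hi : E i ∈ (↑(tailSupport u v) : Set Expo) := by rw [← hEr]; exact ⟨i, rfl⟩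
    simp only [Finset.mem_coe, tailSupport, Finset.mem_union, Finset.mem_biUnion, Finset.mem_univ, true_and,
      mem_support_iff] at hi
    rcases hi with ⟨j, hj⟩ | ⟨j, hj⟩
    · exact hj (by rw [h]; exact hu0 j)
    · exact hj (by rw [h]; exact hv0 j)
  set A : Fin m → Fin s → ℂ := fun j i => coeff (E i) (u j) with hA
  set B : Fin m → Fin s → ℂ := fun j i => coeff (E i) (v j) with hB
  have hF := logDiff_eq_fibreSum E hE u v hu hv
  -- planar coefficient on a zone point = lcoef · G
  have hzone : ∀ d ∈ D, ∀ ν : Fin s → ℕ, ν ≠ 0 → wt (ξ d) (lam E (rep d)) ≤ wt (ξ d) (lam E ν) →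
      logDiff u v (lam E ν) = lcoef ν * umom A B ν := fun d hd ν hν0 hle => by
    rw [hF (lam E ν)]
    exact fibreSum_eq_single E hE0 (fun p => wt (ξ d) (lam E (rep d)) ≤ wt (ξ d) p) (hrep d hd).2.2.2 (umom A B) ν
      hle hν0
  -- empty `D` is trivial; otherwise fix a reference member for the sort
  rcases D.eq_empty_or_nonempty with hDe | ⟨d₀, hd₀⟩
  · simp [hDe]
  let key : Fin s → Lex (ℝ × ℕ) := fun d => toLex (-wt (ξ d₀) (E d), (d : ℕ))
  have hkey : Set.InjOn key ↑D := by
    intro d _ d' _ h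
    have h2 : ((ofLex (key d)).2) = (ofLex (key d')).2 := by rw [h]
    exact Fin.ext (by simpa [key] using h2)
  set q := D.card with hq
  have hcard : (D.image key).card = q := Finset.card_image_of_injOn hkey
  let em : Fin q ↪o Lex (ℝ × ℕ) := (D.image key).orderEmbOfFin hcard
  have hem : ∀ x : Fin q, ∃ d ∈ D, key d = em x := fun x => by
    simpa only [Finset.mem_image] using (D.image key).orderEmbOfFin_mem hcard x
  choose f hfD hfkey using hem
  have hfinj : Function.Injective f := by
    intro x y h
    have : em x = em y := by rw [← hfkey x, ← hfkey y, h]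
    exact em.injective this
  have hfle : ∀ x y : Fin q, x < y → wt (ξ d₀) (E (f y)) ≤ wt (ξ d₀) (E (f x)) := by
    intro x y hxy
    have hlt : key (f x) < key (f y) := by rw [hfkey, hfkey]; exact em.strictMono hxy
    have := (Prod.Lex.toLex_lt_toLex'.1 hlt).1
    simpa [key] using this
  -- the lifted slot matrix through the `2m` signed terms
  let c : Fin m ⊕ Fin m → ℂ := Sum.elim (fun _ => 1) (fun _ => -1)
  let a : Fin m ⊕ Fin m → Fin s → ℂ := Sum.elim A B
  set F : (Fin s → ℕ) → ℂ := fun ν => ∑ k, c k * ∏ i, a k i ^ ν i with hFdef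
  have hFG : ∀ ν, F ν = umom A B ν := fun ν => expSum_elim_eq_umom A B ν
  let ρ : Fin q → (Fin s → ℕ) := fun y => Function.update (rep (f y)) (f y) 0
  let P : Matrix (Fin q) (Fin m ⊕ Fin m) ℂ := fun x k => a k (f x) ^ e
  let Q : Matrix (Fin m ⊕ Fin m) (Fin q) ℂ := fun k y => c k * ∏ i, a k i ^ ρ y i
  have hPQ : ∀ x y, (P * Q) x y = F (ρ y + (Pi.single (f x) e : Fin s → ℕ)) := fun x y => by
    simp only [Matrix.mul_apply, P, Q, hFdef]
    rw [ExpSum.expSum_add_single]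
  have hρself : ∀ y, ρ y + (Pi.single (f y) e : Fin s → ℕ) = rep (f y) := fun y => by
    have := ExpSum.update_add_single (rep (f y)) (f y)
    rw [(hrep (f y) (hfD y)).1] at this
    exact this
  have hrep0 : ∀ y, rep (f y) ≠ 0 := fun y h => by
    have := (hrep (f y) (hfD y)).1
    rw [h] at this
    simp at this
    omega
  have hbound := card_le_of_triangular_factor' P Q (fun y => ?_) (fun x y hxy => ?_)
  · simpa [Fintype.card_sum, Fintype.card_fin, two_mul] using hbound
  · -- diagonal: the member is visible, its fibre a singleton, so `G ≠ 0`
    rw [hPQ, hρself, hFG]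
    obtain ⟨-, htop, -, -⟩ := hrep (f y) (hfD y)
    have hc := hzone (f y) (hfD y) (rep (f y)) (hrep0 y) le_rfl
    intro hG
    exact htop.1 (by rw [hc, hG, mul_zero])
  · -- above the diagonal: the shifted point is in the zone, is not the top, hence has zero coefficient and `G = 0`
    rw [hPQ, hFG]
    obtain ⟨hdiag, htop, hord, hinj⟩ := hrep (f y) (hfD y)
    set pt : Fin s → ℕ := ρ y + (Pi.single (f x) e : Fin s → ℕ) with hpt
    have hxy' : f x ≠ f y := fun h' => (hfinj h' ▸ hxy).false
    have hνne : pt ≠ rep (f y) := by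
      intro h
      have h1 := congrFun h (f y)
      simp only [hpt, Pi.add_apply, ρ, Function.update_self, Pi.single_apply, hxy'.symm, if_false, add_zero] at h1
      rw [hdiag] at h1
      omega
    have hpt0 : pt ≠ 0 := fun h => by
      have h1 := congrFun h (f x)
      simp only [hpt, Pi.add_apply, Pi.single_eq_same, Pi.zero_apply] at h1
      omega
    -- weights: Λ pt = Λ ρ_y + e E_{f x},  Λ rep = Λ ρ_y + e E_{f y}
    have hw1 : wt (ξ (f y)) (lam E pt) = wt (ξ (f y)) (lam E (ρ y)) + (e : ℝ) * wt (ξ (f y)) (E (f x)) := by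
      rw [hpt, lam_add_single, wt_add, wt_nsmul]
    have hw2 : wt (ξ (f y)) (lam E (rep (f y))) = wt (ξ (f y)) (lam E (ρ y)) + (e : ℝ) * wt (ξ (f y)) (E (f y)) := by
      rw [← hρself y, lam_add_single, wt_add, wt_nsmul]
    have hle' : wt (ξ (f y)) (E (f y)) ≤ wt (ξ (f y)) (E (f x)) := by
      have h0 := hfle x y hxy
      have hR : R (f y) (f x) := ((hrep d₀ hd₀).2.2.1 _ _).2 h0
      exact (hord _ _).1 hR
    have hepos : (0 : ℝ) ≤ (e : ℝ) := by positivity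
    have hzle : wt (ξ (f y)) (lam E (rep (f y))) ≤ wt (ξ (f y)) (lam E pt) := by
      rw [hw1, hw2]
      nlinarith [mul_le_mul_of_nonneg_left hle' hepos]
    have hself : rep (f y) ∈ {μ | wt (ξ (f y)) (lam E (rep (f y))) ≤ wt (ξ (f y)) (lam E μ)} := by
      simp only [Set.mem_setOf_eq]; exact le_rfl
    have hne' : lam E pt ≠ lam E (rep (f y)) := fun h => hνne (hinj hzle hself h)
    have hnot : lam E pt ∉ logSupport u v := fun hmem => absurd (htop.2 _ hmem hne') (not_lt.mpr hzle)
    have hzero : logDiff u v (lam E pt) = 0 := by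
      by_contra h
      exact hnot h
    have hc := hzone (f y) (hfD y) pt hpt0 hzle
    rw [hzero] at hc
    exact (mul_eq_zero.mp hc.symm).resolve_left (lcoef_ne_zero pt hpt0)


/-- **COINCIDENCE-CHARGED SLOT BOUND (the exact t-free part of SUB₂).**  Same setting as `planarSlotBound_local`, but the
additive-coincidence hypothesis is only imposed WHERE THE SLOT MATRIX LOOKS: every member `d ∈ D` has a singleton fibre at its
own representative `rep d`, and at each shifted point `(rep d with slot d emptied) + e·e_{d'}` for `d' ∈ D`.  Then `#D ≤ 2m`.
Consequently, for an ARBITRARY slot family `D₀` (hypotheses of `PlanarSlotBound`), `#D₀ ≤ 2m + #{d ∈ D₀ : some slot-shift of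
rep d, or rep d itself, has a non-singleton fibre}` (apply this theorem to the good sub-family): the t-free content of SUB₂ is
exactly `2m`, and ALL multiplicity beyond it is carried by coordinates touched by an additive coincidence of the tail support —
in val-lit p3 g13's staircase (RULING #131) every column is touched by a ghost pair `f_i + f'_j ∈ E`, so the bound is vacuous
there, as it must be. -/
theorem planarSlotBound_charged (u v : Fin m → MvPolynomial (Fin 2) ℂ)
    (hu0 : ∀ j, coeff 0 (u j) = 0) (hv0 : ∀ j, coeff 0 (v j) = 0)
    {s : ℕ} (E : Fin s → Expo) (hE : Function.Injective E) (hEr : Set.range E = ↑(tailSupport u v))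
    (R : Fin s → Fin s → Prop) (e : ℕ) (he : 1 ≤ e) (D : Finset (Fin s)) (rep : Fin s → (Fin s → ℕ))
    (ξ : Fin s → (Fin 2 → ℝ))
    (hrep : ∀ d ∈ D, rep d d = e ∧ IsStrictTop (ξ d) (logSupport u v) (lam E (rep d)) ∧
      (∀ j j' : Fin s, R j j' ↔ wt (ξ d) (E j) ≤ wt (ξ d) (E j')) ∧
      (∀ k : Fin s → ℕ, lam E k = lam E (rep d) → k = rep d) ∧
      (∀ d' ∈ D, ∀ k : Fin s → ℕ,
        lam E k = lam E (Function.update (rep d) d 0 + (Pi.single d' e : Fin s → ℕ)) →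
          k = Function.update (rep d) d 0 + (Pi.single d' e : Fin s → ℕ))) :
    D.card ≤ 2 * m := by
  classical
  have hu : ∀ j, (↑(u j).support : Set Expo) ⊆ Set.range E := fun j x hx => by
    rw [hEr]
    simp only [Finset.mem_coe, tailSupport, Finset.mem_union, Finset.mem_biUnion, Finset.mem_univ, true_and]
    exact Or.inl ⟨j, hx⟩
  have hv : ∀ j, (↑(v j).support : Set Expo) ⊆ Set.range E := fun j x hx => by
    rw [hEr]
    simp only [Finset.mem_coe, tailSupport, Finset.mem_union, Finset.mem_biUnion, Finset.mem_univ, true_and]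
    exact Or.inr ⟨j, hx⟩
  have hE0 : ∀ i, E i ≠ 0 := fun i h => by
    have hi : E i ∈ (↑(tailSupport u v) : Set Expo) := by rw [← hEr]; exact ⟨i, rfl⟩
    simp only [Finset.mem_coe, tailSupport, Finset.mem_union, Finset.mem_biUnion, Finset.mem_univ, true_and,
      mem_support_iff] at hi
    rcases hi with ⟨j, hj⟩ | ⟨j, hj⟩
    · exact hj (by rw [h]; exact hu0 j)
    · exact hj (by rw [h]; exact hv0 j)
  set A : Fin m → Fin s → ℂ := fun j i => coeff (E i) (u j) with hA
  set B : Fin m → Fin s → ℂ := fun j i => coeff (E i) (v j) with hB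
  have hF := logDiff_eq_fibreSum E hE u v hu hv
  -- planar coefficient at a singleton-fibre point = lcoef · G
  have hsingle : ∀ ν : Fin s → ℕ, ν ≠ 0 → (∀ k, lam E k = lam E ν → k = ν) →
      logDiff u v (lam E ν) = lcoef ν * umom A B ν := fun ν hν0 hfib => by
    rw [hF (lam E ν)]
    exact fibreSum_eq_single' E hE0 (umom A B) ν hfib hν0
  rcases D.eq_empty_or_nonempty with hDe | ⟨d₀, hd₀⟩
  · simp [hDe]
  let key : Fin s → Lex (ℝ × ℕ) := fun d => toLex (-wt (ξ d₀) (E d), (d : ℕ))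
  have hkey : Set.InjOn key ↑D := by
    intro d _ d' _ h
    have h2 : ((ofLex (key d)).2) = (ofLex (key d')).2 := by rw [h]
    exact Fin.ext (by simpa [key] using h2)
  set q := D.card with hq
  have hcard : (D.image key).card = q := Finset.card_image_of_injOn hkey
  let em : Fin q ↪o Lex (ℝ × ℕ) := (D.image key).orderEmbOfFin hcard
  have hem : ∀ x : Fin q, ∃ d ∈ D, key d = em x := fun x => by
    simpa only [Finset.mem_image] using (D.image key).orderEmbOfFin_mem hcard x
  choose f hfD hfkey using hem
  have hfinj : Function.Injective f := by
    intro x y h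
    have : em x = em y := by rw [← hfkey x, ← hfkey y, h]
    exact em.injective this
  have hfle : ∀ x y : Fin q, x < y → wt (ξ d₀) (E (f y)) ≤ wt (ξ d₀) (E (f x)) := by
    intro x y hxy
    have hlt : key (f x) < key (f y) := by rw [hfkey, hfkey]; exact em.strictMono hxy
    have := (Prod.Lex.toLex_lt_toLex'.1 hlt).1
    simpa [key] using this
  let c : Fin m ⊕ Fin m → ℂ := Sum.elim (fun _ => 1) (fun _ => -1)
  let a : Fin m ⊕ Fin m → Fin s → ℂ := Sum.elim A B
  set F : (Fin s → ℕ) → ℂ := fun ν => ∑ k, c k * ∏ i, a k i ^ ν i with hFdef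
  have hFG : ∀ ν, F ν = umom A B ν := fun ν => expSum_elim_eq_umom A B ν
  let ρ : Fin q → (Fin s → ℕ) := fun y => Function.update (rep (f y)) (f y) 0
  let P : Matrix (Fin q) (Fin m ⊕ Fin m) ℂ := fun x k => a k (f x) ^ e
  let Q : Matrix (Fin m ⊕ Fin m) (Fin q) ℂ := fun k y => c k * ∏ i, a k i ^ ρ y i
  have hPQ : ∀ x y, (P * Q) x y = F (ρ y + (Pi.single (f x) e : Fin s → ℕ)) := fun x y => by
    simp only [Matrix.mul_apply, P, Q, hFdef]
    rw [ExpSum.expSum_add_single]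
  have hρself : ∀ y, ρ y + (Pi.single (f y) e : Fin s → ℕ) = rep (f y) := fun y => by
    have := ExpSum.update_add_single (rep (f y)) (f y)
    rw [(hrep (f y) (hfD y)).1] at this
    exact this
  have hrep0 : ∀ y, rep (f y) ≠ 0 := fun y h => by
    have := (hrep (f y) (hfD y)).1
    rw [h] at this
    simp at this
    omega
  have hbound := card_le_of_triangular_factor' P Q (fun y => ?_) (fun x y hxy => ?_)
  · simpa [Fintype.card_sum, Fintype.card_fin, two_mul] using hbound
  · rw [hPQ, hρself, hFG]
    obtain ⟨-, htop, -, hfib, -⟩ := hrep (f y) (hfD y)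
    have hc := hsingle (rep (f y)) (hrep0 y) hfib
    intro hG
    exact htop.1 (by rw [hc, hG, mul_zero])
  · rw [hPQ, hFG]
    obtain ⟨hdiag, htop, hord, -, hshift⟩ := hrep (f y) (hfD y)
    set pt : Fin s → ℕ := ρ y + (Pi.single (f x) e : Fin s → ℕ) with hpt
    have hxy' : f x ≠ f y := fun h' => (hfinj h' ▸ hxy).false
    have hνne : pt ≠ rep (f y) := by
      intro h
      have h1 := congrFun h (f y)
      simp only [hpt, Pi.add_apply, ρ, Function.update_self, Pi.single_apply, hxy'.symm, if_false, add_zero] at h1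
      rw [hdiag] at h1
      omega
    have hpt0 : pt ≠ 0 := fun h => by
      have h1 := congrFun h (f x)
      simp only [hpt, Pi.add_apply, Pi.single_eq_same, Pi.zero_apply] at h1
      omega
    have hw1 : wt (ξ (f y)) (lam E pt) = wt (ξ (f y)) (lam E (ρ y)) + (e : ℝ) * wt (ξ (f y)) (E (f x)) := by
      rw [hpt, lam_add_single, wt_add, wt_nsmul]
    have hw2 : wt (ξ (f y)) (lam E (rep (f y))) = wt (ξ (f y)) (lam E (ρ y)) + (e : ℝ) * wt (ξ (f y)) (E (f y)) := by
      rw [← hρself y, lam_add_single, wt_add, wt_nsmul]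
    have hle' : wt (ξ (f y)) (E (f y)) ≤ wt (ξ (f y)) (E (f x)) := by
      have h0 := hfle x y hxy
      have hR : R (f y) (f x) := ((hrep d₀ hd₀).2.2.1 _ _).2 h0
      exact (hord _ _).1 hR
    have hepos : (0 : ℝ) ≤ (e : ℝ) := by positivity
    have hzle : wt (ξ (f y)) (lam E (rep (f y))) ≤ wt (ξ (f y)) (lam E pt) := by
      rw [hw1, hw2]
      nlinarith [mul_le_mul_of_nonneg_left hle' hepos]
    have hfibpt : ∀ k, lam E k = lam E pt → k = pt := hshift (f x) (hfD x)
    have hne' : lam E pt ≠ lam E (rep (f y)) := fun h => hνne (by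
      obtain ⟨-, -, -, hfib, -⟩ := hrep (f y) (hfD y)
      exact (hfib pt h))
    have hnot : lam E pt ∉ logSupport u v := fun hmem => absurd (htop.2 _ hmem hne') (not_lt.mpr hzle)
    have hzero : logDiff u v (lam E pt) = 0 := by
      by_contra h
      exact hnot h
    have hc := hsingle pt hpt0 hfibpt
    rw [hzero] at hc
    exact (mul_eq_zero.mp hc.symm).resolve_left (lcoef_ne_zero pt hpt0)


/-- **COROLLARY (the counting form used by crux idea `coincidence-dichotomy`).**  For ANY slot family in a cell and any
set `T ⊆ D` containing every coincidence-TOUCHED member (i.e. every member outside `T` has singleton fibres at its representative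
and at all its slot shifts towards members of `D`), `#D ≤ 2m + #T`: the `t`-free part of the dead SUB₂ is exactly `2m`, and all
further multiplicity is charged to additive coincidences of the tail support. -/
theorem card_le_two_mul_add_card_touched (u v : Fin m → MvPolynomial (Fin 2) ℂ)
    (hu0 : ∀ j, coeff 0 (u j) = 0) (hv0 : ∀ j, coeff 0 (v j) = 0)
    {s : ℕ} (E : Fin s → Expo) (hE : Function.Injective E) (hEr : Set.range E = ↑(tailSupport u v))
    (R : Fin s → Fin s → Prop) (e : ℕ) (he : 1 ≤ e) (D T : Finset (Fin s)) (hTD : T ⊆ D)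
    (rep : Fin s → (Fin s → ℕ)) (ξ : Fin s → (Fin 2 → ℝ))
    (hrep : ∀ d ∈ D, rep d d = e ∧ IsStrictTop (ξ d) (logSupport u v) (lam E (rep d)) ∧
      (∀ j j' : Fin s, R j j' ↔ wt (ξ d) (E j) ≤ wt (ξ d) (E j')))
    (huntouched : ∀ d ∈ D, d ∉ T →
      (∀ k : Fin s → ℕ, lam E k = lam E (rep d) → k = rep d) ∧
      (∀ d' ∈ D, ∀ k : Fin s → ℕ,
        lam E k = lam E (Function.update (rep d) d 0 + (Pi.single d' e : Fin s → ℕ)) →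
          k = Function.update (rep d) d 0 + (Pi.single d' e : Fin s → ℕ))) :
    D.card ≤ 2 * m + T.card := by
  classical
  have h0 : (D \ T).card ≤ 2 * m := by
    refine planarSlotBound_charged u v hu0 hv0 E hE hEr R e he (D \ T) rep ξ ?_
    intro d hd
    rw [Finset.mem_sdiff] at hd
    obtain ⟨h1, h2, h3⟩ := hrep d hd.1
    obtain ⟨hg1, hg2⟩ := huntouched d hd.1 hd.2
    refine ⟨h1, h2, h3, hg1, ?_⟩
    intro d' hd' k hk
    exact hg2 d' (Finset.mem_sdiff.mp hd').1 k hk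
  have hsplit := Finset.card_sdiff_add_card_eq_card hTD
  omega

end Summit.ValiantsHypothesis.ValiantsHypothesis.Cruxes.TwoProducts.PlanarCellRung

end
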